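import Mathlib

/-!
# T5PullbackInjective — pull-back by a non-constant holomorphic map is injective on 1-forms

Kernel support (blind cell pub-hodge-repro2, seat p6) for route/T5-N1-hodge-p6.md, Remark H7.3,
the parenthesis «elementary check on 1-forms: `k^*α = 0` for holomorphic `α` forces `α = 0` on the
non-empty open set of regular values of `k`» (used there to see that `k^* : H^1(R, ℚ) → H^1(S_j, ℚ)`
is injective for the Castelnuovo–de Franchis fibration `k : S_j → R`, Voisin Lemma 7.28).

Chart model. `k : E → ℂ` is holomorphic on a connected open `U` of a complex normed space `E`
(`E = ℂ²` for a chart of the surface `S_j`; `ℂ` = a chart of the curve `R` with coordinate `w`);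
a holomorphic 1-form `α = a(w) dw` on the curve is its coefficient `a : ℂ → ℂ`; its pull-back is
`k^*α = a(k(z)) · dk_z`, and the hypothesis `k^*α = 0` reads `a (k z) • fderiv ℂ k z = 0` for all
`z ∈ U`.

* `eventuallyEq_const_of_eventually_fderiv_eq_zero`, `eqOn_const_of_eventually_fderiv_eq_zero`:
  a holomorphic function whose differential vanishes near one point of a connected open set is
  constant on it (mean value inequality on a ball + identity theorem);
* `frequently_fderiv_ne_zero`, `subset_closure_regular`: for a NON-constant `k` the regular points
  `{dk ≠ 0}` are dense in `U` (§H7.3's «non-empty open set of regular values» — here its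
  pre-image, dense in the source);
* `eqOn_zero_of_pullback_eq_zero`: `k^*(a dw) = 0` on `U` with `a` continuous forces `a ∘ k = 0` on
  `U`, hence `a = 0` on the image `k '' U`;
* `isOpen_image_of_not_const`, `eqOn_zero_image_of_pullback_eq_zero`: that image is a non-empty
  OPEN subset of the curve (Mathlib's open mapping theorem `AnalyticOnNhd.is_constant_or_isOpen`);
* `eqOn_zero_of_pullback_eq_zero_of_analyticOn`: if `a` is moreover holomorphic on a connected
  open `V ⊇ k '' U`, then `a = 0` on all of `V` — «`k^*α = 0` forces `α = 0`».

All declarations: Mathlib only, no `sorry`, axioms ⊆ {propext, Classical.choice, Quot.sound}.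
-/

namespace Summit.Ventures.HodgeRepro2.T5PullbackInjective

open Filter Topology Set Metric

variable {E : Type*} [NormedAddCommGroup E] [NormedSpace ℂ E] {k : E → ℂ} {U : Set E}

/-! ### Vanishing differential near a point forces local constancy -/

/-- If `k` is holomorphic on the open set `U ∋ z₀` and `dk = 0` near `z₀`, then `k` is constant
near `z₀` (the mean value inequality on a small ball, `Convex.is_const_of_fderivWithin_eq_zero`). -/
theorem eventuallyEq_const_of_eventually_fderiv_eq_zero (hk : AnalyticOnNhd ℂ k U) (hU : IsOpen U)
    {z₀ : E} (hz₀ : z₀ ∈ U) (h : ∀ᶠ z in 𝓝 z₀, fderiv ℂ k z = 0) :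
    k =ᶠ[𝓝 z₀] fun _ => k z₀ := by
  obtain ⟨r, hr, hball⟩ := Metric.eventually_nhds_iff_ball.mp ((hU.eventually_mem hz₀).and h)
  show ∀ᶠ z in 𝓝 z₀, k z = k z₀
  refine Metric.eventually_nhds_iff_ball.mpr ⟨r, hr, fun z hz => ?_⟩
  have hdiff : DifferentiableOn ℂ k (ball z₀ r) := fun x hx =>
    (hk x (hball x hx).1).differentiableAt.differentiableWithinAt
  have hder : ∀ x ∈ ball z₀ r, fderivWithin ℂ k (ball z₀ r) x = 0 := fun x hx => by
    rw [fderivWithin_of_isOpen isOpen_ball hx]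
    exact (hball x hx).2
  exact (convex_ball z₀ r).is_const_of_fderivWithin_eq_zero hdiff hder hz (mem_ball_self hr)

/-- **Identity theorem form.** If `k` is holomorphic on the connected open set `U ∋ z₀` and
`dk = 0` near `z₀`, then `k` is constant on all of `U`. -/
theorem eqOn_const_of_eventually_fderiv_eq_zero (hk : AnalyticOnNhd ℂ k U) (hU : IsOpen U)
    (hUc : IsPreconnected U) {z₀ : E} (hz₀ : z₀ ∈ U) (h : ∀ᶠ z in 𝓝 z₀, fderiv ℂ k z = 0) :
    EqOn k (fun _ => k z₀) U :=
  hk.eqOn_of_preconnected_of_eventuallyEq analyticOnNhd_const hUc hz₀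
    (eventuallyEq_const_of_eventually_fderiv_eq_zero hk hU hz₀ h)

/-! ### Regular points of a non-constant holomorphic function are dense -/

/-- If `k` is holomorphic and NOT constant on the connected open `U`, then near every point of `U`
there are points where `dk ≠ 0`. -/
theorem frequently_fderiv_ne_zero (hk : AnalyticOnNhd ℂ k U) (hU : IsOpen U)
    (hUc : IsPreconnected U) (hnc : ¬ ∃ w, ∀ z ∈ U, k z = w) {z₀ : E} (hz₀ : z₀ ∈ U) :
    ∃ᶠ z in 𝓝 z₀, fderiv ℂ k z ≠ 0 := by
  by_contra hcon
  rw [Filter.not_frequently] at hcon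
  simp only [not_not] at hcon
  exact hnc ⟨k z₀, fun z hz => eqOn_const_of_eventually_fderiv_eq_zero hk hU hUc hz₀ hcon hz⟩

/-- **Regular points are dense.** For `k` holomorphic and non-constant on the connected open `U`,
`U` lies in the closure of its regular points `{z ∈ U | dk_z ≠ 0}`. -/
theorem subset_closure_regular (hk : AnalyticOnNhd ℂ k U) (hU : IsOpen U) (hUc : IsPreconnected U)
    (hnc : ¬ ∃ w, ∀ z ∈ U, k z = w) : U ⊆ closure {z ∈ U | fderiv ℂ k z ≠ 0} := by
  intro z₀ hz₀
  rw [mem_closure_iff_frequently]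
  exact ((frequently_fderiv_ne_zero hk hU hUc hnc hz₀).and_eventually (hU.eventually_mem hz₀)).mono
    fun z hz => ⟨hz.2, hz.1⟩

/-! ### The pull-back of a 1-form vanishes only if the form vanishes on the image -/

/-- At a regular point `z` of `k`, `a (k z) • dk_z = 0` forces `a (k z) = 0`. -/
theorem apply_eq_zero_of_smul_fderiv_eq_zero {a : ℂ → ℂ} {z : E} (hz : fderiv ℂ k z ≠ 0)
    (h : a (k z) • fderiv ℂ k z = 0) : a (k z) = 0 :=
  (smul_eq_zero.mp h).resolve_right hz

/-- **`k^*(a dw) = 0` forces `a ∘ k = 0` on `U`.** For `k` holomorphic and non-constant on the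
connected open `U` and `a` continuous on the image `k '' U`: if `a (k z) • dk_z = 0` for all
`z ∈ U`, then `a (k z) = 0` for all `z ∈ U` (true at the dense set of regular points, then by
continuity everywhere). -/
theorem eqOn_zero_of_pullback_eq_zero (hk : AnalyticOnNhd ℂ k U) (hU : IsOpen U)
    (hUc : IsPreconnected U) (hnc : ¬ ∃ w, ∀ z ∈ U, k z = w) {a : ℂ → ℂ}
    (ha : ContinuousOn a (k '' U)) (h : ∀ z ∈ U, a (k z) • fderiv ℂ k z = 0) :
    EqOn (a ∘ k) 0 U := by
  have hreg : EqOn (a ∘ k) 0 {z ∈ U | fderiv ℂ k z ≠ 0} := fun z hz =>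
    apply_eq_zero_of_smul_fderiv_eq_zero hz.2 (h z hz.1)
  have hcont : ContinuousOn (a ∘ k) U :=
    ha.comp (hk.continuousOn) (mapsTo_image k U)
  exact hreg.of_subset_closure hcont continuousOn_const (fun z hz => hz.1)
    (subset_closure_regular hk hU hUc hnc)

/-- **Open mapping.** The image of a connected open set under a non-constant holomorphic function
is open (`AnalyticOnNhd.is_constant_or_isOpen`). -/
theorem isOpen_image_of_not_const (hk : AnalyticOnNhd ℂ k U) (hU : IsOpen U)
    (hUc : IsPreconnected U) (hnc : ¬ ∃ w, ∀ z ∈ U, k z = w) : IsOpen (k '' U) :=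
  ((hk.is_constant_or_isOpen hUc).resolve_left hnc) U Subset.rfl hU

/-- **§H7.3, the elementary check.** `k^*(a dw) = 0` on `U` forces `a = 0` on the image `k '' U`,
which is a non-empty open subset of the curve (the «open set of regular values» of §H7.3 — in fact
all of `k '' U`). -/
theorem eqOn_zero_image_of_pullback_eq_zero (hk : AnalyticOnNhd ℂ k U) (hU : IsOpen U)
    (hUc : IsPreconnected U) (hnc : ¬ ∃ w, ∀ z ∈ U, k z = w) (hne : U.Nonempty) {a : ℂ → ℂ}
    (ha : ContinuousOn a (k '' U)) (h : ∀ z ∈ U, a (k z) • fderiv ℂ k z = 0) :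
    EqOn a 0 (k '' U) ∧ IsOpen (k '' U) ∧ (k '' U).Nonempty := by
  refine ⟨?_, isOpen_image_of_not_const hk hU hUc hnc, hne.image k⟩
  rintro w ⟨z, hz, rfl⟩
  exact eqOn_zero_of_pullback_eq_zero hk hU hUc hnc ha h hz

/-- **`k^* α = 0 ⇒ α = 0`.** If moreover `a` is holomorphic on a connected open `V ⊇ k '' U`
(the curve `R`, or a chart of it), then `a = 0` on all of `V`: the pull-back by a non-constant
holomorphic map is injective on holomorphic 1-forms (identity theorem on the curve, applied at a
point of the non-empty open set `k '' U` on which `a` vanishes). -/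
theorem eqOn_zero_of_pullback_eq_zero_of_analyticOn (hk : AnalyticOnNhd ℂ k U) (hU : IsOpen U)
    (hUc : IsPreconnected U) (hnc : ¬ ∃ w, ∀ z ∈ U, k z = w) (hne : U.Nonempty) {a : ℂ → ℂ}
    {V : Set ℂ} (ha : AnalyticOnNhd ℂ a V) (hVc : IsPreconnected V) (hV : k '' U ⊆ V)
    (h : ∀ z ∈ U, a (k z) • fderiv ℂ k z = 0) : EqOn a 0 V := by
  obtain ⟨hzero, hopen, ⟨w₀, hw₀⟩⟩ :=
    eqOn_zero_image_of_pullback_eq_zero hk hU hUc hnc hne (ha.continuousOn.mono hV) h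
  refine ha.eqOn_zero_of_preconnected_of_eventuallyEq_zero hVc (hV hw₀) ?_
  filter_upwards [hopen.mem_nhds hw₀] with w hw using hzero hw

end Summit.Ventures.HodgeRepro2.T5PullbackInjective
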